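import Mathlib
import Summits.CriticalPhenomena.SAWScalingLimit.Theorems.SAWDefectDecoherenceSectorSlavingDefs
import Summits.CriticalPhenomena.SAWScalingLimit.Theorems.SAWDefectDecoherenceDefectDecoherenceTmAdmissible
import Summits.CriticalPhenomena.SAWScalingLimit.Theorems.SAWDefectDecoherenceDefectDecoherenceSsTipRegroupingAux2
import HarnessLib

/-!
# Star-mass Harnack, auxiliary file 1: the return loops at a tip, re-summed over their prefix
(helpers for the stub `stub_starMassHarnack` of the line `sector-slaving`, crux `DefectDecoherence`,
stmt-CriticalPhenomena-8549)

Fix a root `a = s(u,w)` with `u ∉ Λ`, a vertex `t ∈ Λ` (`t ≠ w`) and a dart `s → t`, `s ∈ star Λ t`.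
A RETURN LOOP at `(t, s)` is a walk `γ : a → s(s,t)` with last vertex `s` that has ALREADY visited `t`:
`γ = [π…, q, …, s]` where the prefix `π` ends at `t` and `q ∼ t` is the vertex after `t`.  Cutting
at `t` (`har_exists_cut`) exhibits `γ` uniquely as `π ++ τ` with `π : a → s(t,q)` a via-`t` walk
avoiding `s`, `q ∈ star Λ t ∖ {s}`, and `τ : s(t,q) → s(s,t)` a walk of the SLIT DOMAIN `Λ ∖ π`
(both end mid-edges of `τ` are boundary mid-edges of the slit domain at the removed vertex `t`);
gluing back is `glueW`.  Whence the re-summation identity `har_sum_returnLoop` and, under a bound `N`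
on the `x_c`-mass of the walks of a simply connected domain between two adjacent boundary mid-edges
(the slit domain is simply connected, `simplyConnected_sdiff`), the bound `har_returnLoop_le`:
return-loop mass at `(t,s)` `≤ N ·` (mass of the via-`t` walks at the two other mid-edges of `t`
avoiding `s`).

Sources: H. Duminil-Copin, S. Smirnov, Ann. of Math. 175 (2012) (arXiv:1007.0575), §1–§2 (walks
between mid-edges); the line card `Lines/sector-slaving.md`.
-/

noncomputable section

open scoped BigOperators ComplexConjugate Classical
open Literature.Probability.LatticeModels Literature.Probability.RandomPlanarGeometry.SAW
open Summit.CriticalPhenomena.SAWScalingLimit.Theorems.DefectDecoherence.TipMartingale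

namespace Summit.CriticalPhenomena.SAWScalingLimit.Theorems.DefectDecoherence.SectorSlaving

/-! ### Cutting a walk at a visited vertex -/

/-- **Cutting a walk in two.** If the vertex list of `γ : a → b` is `P ++ Q` with `P`, `Q` nonempty,
`y` the last vertex of `P` and `z` the first vertex of `Q`, then `P` is a walk `a → s(y,z)` of `D`
and `Q` is a walk `s(y,z) → b` of the slit domain `D ∖ P`. [folklore] -/
theorem har_exists_cut {D : Finset HexVertex} {a b : Sym2 HexVertex} (γ : HexMidEdgeSAW D a b)
    {P Q : List HexVertex} (hPQ : γ.verts = P ++ Q) (hP : P ≠ []) (hQ : Q ≠ []) {y z : HexVertex}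
    (hy : P.getLast hP = y) (hz : Q.head hQ = z) :
    ∃ π : HexMidEdgeSAW D a s(y, z), π.verts = P ∧
      ∃ τ : HexMidEdgeSAW (D \ π.verts.toFinset) s(y, z) b, τ.verts = Q := by
  subst hy hz
  have hne : γ.verts ≠ [] := by rw [hPQ]; simp [hP]
  have hN := γ.nodup
  rw [hPQ] at hN
  have hC := γ.isChain
  rw [hPQ] at hC
  have hE := γ.edges_nodup hne
  rw [hPQ, edges_append _ _ hP hQ] at hE
  have e : a :: (List.zipWith (fun u w => s(u, w)) P P.tail ++
      s(P.getLast hP, Q.head hQ) :: List.zipWith (fun u w => s(u, w)) Q Q.tail) ++ [b] =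
      (a :: List.zipWith (fun u w => s(u, w)) P P.tail ++ [s(P.getLast hP, Q.head hQ)]) ++
        (List.zipWith (fun u w => s(u, w)) Q Q.tail ++ [b]) := by simp
  have e' : a :: (List.zipWith (fun u w => s(u, w)) P P.tail ++
      s(P.getLast hP, Q.head hQ) :: List.zipWith (fun u w => s(u, w)) Q Q.tail) ++ [b] =
      (a :: List.zipWith (fun u w => s(u, w)) P P.tail) ++
        (s(P.getLast hP, Q.head hQ) :: List.zipWith (fun u w => s(u, w)) Q Q.tail ++ [b]) := by
    simp
  have hdis : ∀ x ∈ Q, x ∉ P := fun x hx h => (List.nodup_append.1 hN).2.2 x h x hx rfl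
  have hadj : hexGraph.Adj (P.getLast hP) (Q.head hQ) := hC.rel_getLast_head_of_append hP hQ
  refine ⟨
    { verts := P
      subset := fun x hx => γ.subset x (by rw [hPQ]; exact List.mem_append_left _ hx)
      nodup := (List.nodup_append.1 hN).1
      isChain := hC.left_of_append
      head_mem := fun x hx => γ.head_mem x (by rw [hPQ, List.head?_append, hx]; rfl)
      getLast_mem := fun x hx => by
        rw [List.getLast?_eq_some_getLast hP, Option.some.injEq] at hx
        rw [← hx]; exact Sym2.mem_mk_left _ _
      eq_of_nil := fun h => (hP h).elim
      edges_nodup := fun _ => by rw [e] at hE; exact (List.nodup_append.1 hE).1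
      fst_mem := γ.fst_mem }, rfl,
    { verts := Q
      subset := fun x hx => Finset.mem_sdiff.2 ⟨γ.subset x (by
          rw [hPQ]; exact List.mem_append_right _ hx),
        fun h => hdis x hx (List.mem_toFinset.1 h)⟩
      nodup := (List.nodup_append.1 hN).2.1
      isChain := hC.right_of_append
      head_mem := fun x hx => by
        rw [List.head?_eq_some_head hQ, Option.some.injEq] at hx
        rw [← hx]; exact Sym2.mem_mk_right _ _
      getLast_mem := fun x hx => γ.getLast_mem x (by rw [hPQ, List.getLast?_append, hx]; rfl)
      eq_of_nil := fun h => (hQ h).elim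
      edges_nodup := fun _ => by rw [e'] at hE; exact (List.nodup_append.1 hE).2.1
      fst_mem := ⟨(SimpleGraph.mem_edgeSet _).2 hadj, _, Sym2.mem_mk_right _ _,
        Finset.mem_sdiff.2 ⟨γ.subset _ (by
            rw [hPQ]; exact List.mem_append_right _ (List.head_mem hQ)),
          fun h => hdis _ (List.head_mem hQ) (List.mem_toFinset.1 h)⟩⟩ }, rfl⟩

/-- A list containing `t` decomposes UNIQUELY as `prefix ++ t :: suffix` with `t ∉ prefix`.
[folklore] -/
theorem har_append_cons_inj {α : Type*} [DecidableEq α] {t : α} {L L' R R' : List α}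
    (h : L ++ t :: R = L' ++ t :: R') (hL : t ∉ L) (hL' : t ∉ L') : L = L' ∧ R = R' := by
  have key : ∀ {A B : List α}, t ∉ A →
      (A ++ t :: B).takeWhile (fun x => decide (x ≠ t)) = A := by
    intro A B hA
    rw [List.takeWhile_append_of_pos (fun x hx => by simpa using ne_of_mem_of_not_mem hx hA),
      List.takeWhile_cons_of_neg (by simp), List.append_nil]
  have hLL' : L = L' := by rw [← key (B := R) hL, h, key hL']
  subst hLL'
  exact ⟨rfl, (List.cons.inj (List.append_cancel_left h)).2⟩

/-! ### Prefix and continuation of a return loop -/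

section ReturnLoop

variable {Λ : Finset HexVertex} {a b : Sym2 HexVertex} {u w t q s : HexVertex}

/-- A walk of a domain `Λ'` between the two mid-edges `s(t,q)`, `s(s,t)` (`t ≠ s`, `q ≠ s`) is
nontrivial. [folklore] -/
theorem har_verts_ne_nil {Λ' : Finset HexVertex} (hts : t ≠ s) (hqs : q ≠ s)
    (τ : HexMidEdgeSAW Λ' s(t, q) s(s, t)) : τ.verts ≠ [] := fun h => by
  rcases Sym2.eq_iff.1 (τ.eq_of_nil h) with ⟨h1, _⟩ | ⟨_, h2⟩
  · exact hts h1
  · exact hqs h2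

/-- A nontrivial continuation, in the slit domain `Λ ∖ π`, of a prefix `π` ending at `t`, started
at the (boundary) mid-edge `s(t,q)` of the slit domain, starts at `q`. [folklore] -/
theorem har_head_eq (π : HexMidEdgeSAW Λ a s(t, q)) (hl : π.verts.getLast? = some t)
    (τ : HexMidEdgeSAW (Λ \ π.verts.toFinset) s(t, q) b) (hne : τ.verts ≠ []) :
    τ.verts.head? = some q := by
  rw [List.head?_eq_some_head hne, Option.some.injEq]
  have hm := τ.head_mem _ (List.head?_eq_some_head hne)
  rcases Sym2.mem_iff.1 hm with e | e
  · have h := (Finset.mem_sdiff.1 (τ.subset _ (List.head_mem hne))).2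
    rw [e] at h
    exact absurd (List.mem_toFinset.2 (List.mem_of_getLast? hl)) h
  · exact e

/-- … and, if it ends on the mid-edge `s(s,t)`, its last vertex is `s`. [folklore] -/
theorem har_getLast_eq (π : HexMidEdgeSAW Λ a s(t, q)) (hl : π.verts.getLast? = some t)
    (τ : HexMidEdgeSAW (Λ \ π.verts.toFinset) s(t, q) s(s, t)) (hne : τ.verts ≠ []) :
    τ.verts.getLast? = some s := by
  rw [List.getLast?_eq_some_getLast hne, Option.some.injEq]
  have hm := τ.getLast_mem _ (List.getLast?_eq_some_getLast hne)
  rcases Sym2.mem_iff.1 hm with e | e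
  · exact e
  · have h := (Finset.mem_sdiff.1 (τ.subset _ (List.getLast_mem hne))).2
    rw [e] at h
    exact absurd (List.mem_toFinset.2 (List.mem_of_getLast? hl)) h

/-- Extensionality for the triples (dart, prefix, continuation). [folklore] -/
theorem har_sigma_ext
    {x y : (q : HexVertex) × (π : HexMidEdgeSAW Λ a s(t, q)) ×
      HexMidEdgeSAW (Λ \ π.verts.toFinset) s(t, q) b}
    (h1 : x.1 = y.1) (h2 : x.2.1.verts = y.2.1.verts) (h3 : x.2.2.verts = y.2.2.verts) :
    x = y := by
  obtain ⟨q, π, τ⟩ := x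
  obtain ⟨q', π', τ'⟩ := y
  dsimp only at h1 h2 h3
  subst h1
  obtain rfl : π = π' := HexMidEdgeSAW.ext h2
  obtain rfl : τ = τ' := HexMidEdgeSAW.ext h3
  rfl

/-- **Return loops re-summed over their prefix (the bijection as a sum identity).**  For `u ∉ Λ ∋ t`,
`w ≠ t`, `s ∈ star Λ t` and any functional `Ψ` of the vertex list: summing `Ψ` over the return loops
at `(t,s)` — walks `s(u,w) → s(s,t)` with last vertex `s` having visited `t` — is summing
`Ψ(π ++ τ)` over the darts `q ∈ star Λ t ∖ {s}`, the via-`t` walks `π : s(u,w) → s(t,q)` (last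
vertex `t`) avoiding `s`, and the walks `τ : s(t,q) → s(s,t)` of the slit domain `Λ ∖ π`. [folklore] -/
theorem har_sum_returnLoop {M : Type*} [AddCommMonoid M] (hu : u ∉ Λ) (ht : t ∈ Λ) (hwt : w ≠ t)
    (hs : s ∈ star Λ t) (Ψ : List HexVertex → M) :
    ∑ γ : HexMidEdgeSAW Λ s(u, w) s(s, t),
        (if γ.verts.getLast? = some s ∧ t ∈ γ.verts then Ψ γ.verts else 0) =
      ∑ q ∈ star Λ t, ∑ π : HexMidEdgeSAW Λ s(u, w) s(t, q),
        if π.verts.getLast? = some t ∧ s ∉ π.verts then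
          (if q = s then 0 else
            ∑ τ : HexMidEdgeSAW (Λ \ π.verts.toFinset) s(t, q) s(s, t), Ψ (π.verts ++ τ.verts))
        else 0 := by
  obtain ⟨hsΛ, hts⟩ := tip_mem_star.1 hs
  have hab : s(u, w) ≠ s(s, t) := fun e => by
    have hm : u ∈ s(s, t) := by rw [← e]; exact Sym2.mem_mk_left u w
    rcases Sym2.mem_iff.1 hm with rfl | rfl
    · exact hu hsΛ
    · exact hu ht
  -- both sides are sums of `Ψ` over finite sets of vertex lists
  set A : Finset (List HexVertex) :=
    (Finset.univ.filter fun γ : HexMidEdgeSAW Λ s(u, w) s(s, t) =>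
      γ.verts.getLast? = some s ∧ t ∈ γ.verts).image fun γ => γ.verts with hA
  set T : Finset ((q : HexVertex) × (π : HexMidEdgeSAW Λ s(u, w) s(t, q)) ×
      HexMidEdgeSAW (Λ \ π.verts.toFinset) s(t, q) s(s, t)) :=
    (star Λ t).sigma fun q => (Finset.univ.filter fun π : HexMidEdgeSAW Λ s(u, w) s(t, q) =>
      (π.verts.getLast? = some t ∧ s ∉ π.verts) ∧ q ≠ s).sigma fun _ => Finset.univ with hT
  set B : Finset (List HexVertex) := T.image fun x => x.2.1.verts ++ x.2.2.verts with hB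
  have hmemT : ∀ {x}, x ∈ T ↔
      x.1 ∈ star Λ t ∧ (x.2.1.verts.getLast? = some t ∧ s ∉ x.2.1.verts) ∧ x.1 ≠ s := by
    intro x
    simp only [hT, Finset.mem_sigma, Finset.mem_filter, Finset.mem_univ, true_and, and_true]
  -- facts about a triple of `T`
  have hTne : ∀ {x}, x ∈ T → x.2.2.verts ≠ [] := fun hx =>
    har_verts_ne_nil hts.ne (hmemT.1 hx).2.2 _
  have hTsplit : ∀ {x}, x ∈ T → x.2.1.verts.dropLast ++ t :: x.2.2.verts =
      x.2.1.verts ++ x.2.2.verts ∧ t ∉ x.2.1.verts.dropLast := by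
    intro x hx
    have hl := (hmemT.1 hx).2.1.1
    have e : x.2.1.verts.dropLast ++ [t] = x.2.1.verts := List.dropLast_append_getLast? t hl
    refine ⟨?_, fun hmem => ?_⟩
    · have e2 : x.2.1.verts ++ x.2.2.verts = (x.2.1.verts.dropLast ++ [t]) ++ x.2.2.verts :=
        congrArg (· ++ x.2.2.verts) e.symm
      rw [e2]; simp
    have hnd := x.2.1.nodup
    rw [← e, List.nodup_append] at hnd
    exact hnd.2.2 t hmem t (List.mem_singleton_self t) rfl
  have hLHS : ∑ γ : HexMidEdgeSAW Λ s(u, w) s(s, t),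
      (if γ.verts.getLast? = some s ∧ t ∈ γ.verts then Ψ γ.verts else 0) = ∑ l ∈ A, Ψ l := by
    rw [hA, Finset.sum_image fun x _ y _ h => HexMidEdgeSAW.ext h, Finset.sum_filter]
  have hRHS : (∑ q ∈ star Λ t, ∑ π : HexMidEdgeSAW Λ s(u, w) s(t, q),
      if π.verts.getLast? = some t ∧ s ∉ π.verts then
        (if q = s then 0 else
          ∑ τ : HexMidEdgeSAW (Λ \ π.verts.toFinset) s(t, q) s(s, t), Ψ (π.verts ++ τ.verts))
      else 0) = ∑ l ∈ B, Ψ l := by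
    rw [hB, Finset.sum_image, hT, Finset.sum_sigma]
    · refine Finset.sum_congr rfl fun q _ => ?_
      rw [Finset.sum_sigma, Finset.sum_filter]
      refine Finset.sum_congr rfl fun π _ => ?_
      by_cases h1 : π.verts.getLast? = some t ∧ s ∉ π.verts
      · by_cases h2 : q = s
        · rw [if_pos h1, if_pos h2, if_neg (fun h => h.2 h2)]
        · rw [if_pos h1, if_neg h2, if_pos ⟨h1, h2⟩]
      · rw [if_neg h1, if_neg (fun h => h1 h.1)]
    · -- the concatenation is injective on `T`
      intro x hx' y hy' hxy
      have hx : x ∈ T := Finset.mem_coe.1 hx'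
      have hy : y ∈ T := Finset.mem_coe.1 hy'
      dsimp only at hxy
      obtain ⟨ex, htx⟩ := hTsplit hx
      obtain ⟨ey, hty⟩ := hTsplit hy
      rw [← ex, ← ey] at hxy
      obtain ⟨e1, e2⟩ := har_append_cons_inj hxy htx hty
      have eπ : x.2.1.verts = y.2.1.verts :=
        calc x.2.1.verts = x.2.1.verts.dropLast ++ [t] :=
              (List.dropLast_append_getLast? t (hmemT.1 hx).2.1.1).symm
          _ = y.2.1.verts.dropLast ++ [t] := by rw [e1]
          _ = y.2.1.verts := List.dropLast_append_getLast? t (hmemT.1 hy).2.1.1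
      refine har_sigma_ext ?_ eπ e2
      have h1 := har_head_eq x.2.1 (hmemT.1 hx).2.1.1 x.2.2 (hTne hx)
      have h2 := har_head_eq y.2.1 (hmemT.1 hy).2.1.1 y.2.2 (hTne hy)
      rw [e2, h2] at h1
      exact (Option.some_injective _ h1).symm
  rw [hLHS, hRHS]
  -- the two sets of lists coincide
  congr 1
  ext l
  simp only [hA, hB, Finset.mem_image, Finset.mem_filter, Finset.mem_univ, true_and]
  constructor
  · -- cut a return loop at `t`
    rintro ⟨γ, ⟨hγs, hγt⟩, rfl⟩
    obtain ⟨L, R, hLR⟩ := List.append_of_mem hγt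
    have hnd := γ.nodup
    rw [hLR, List.nodup_append] at hnd
    obtain ⟨-, hnd2, hdis⟩ := hnd
    rw [hLR, List.getLast?_append, List.getLast?_eq_some_getLast (List.cons_ne_nil _ _),
      Option.some_or, Option.some.injEq] at hγs
    -- the vertex after `t`
    obtain ⟨r, R', rfl⟩ : ∃ r R', R = r :: R' := by
      refine List.exists_cons_of_ne_nil ?_
      rintro rfl
      exact hts.ne hγs
    rw [List.getLast_cons_cons] at hγs
    have hsR : s ∈ r :: R' := hγs ▸ List.getLast_mem _
    have hPQ : γ.verts = (L ++ [t]) ++ (r :: R') := by rw [hLR]; simp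
    obtain ⟨π, hπ, τ, hτ⟩ :=
      har_exists_cut γ hPQ (by simp) (List.cons_ne_nil _ _) (y := t) (z := r) (by simp) rfl
    have hch := γ.isChain
    rw [hLR, List.isChain_append_cons_cons] at hch
    have hrΛ : r ∈ Λ := γ.subset r (by rw [hLR]; simp)
    -- no U-turn on the final mid-edge: the vertex after `t` is not `s`
    have hrs : r ≠ s := by
      intro hrs
      subst hrs
      have hR' : R' = [] := by
        by_contra hR'
        rw [List.getLast_cons hR'] at hγs
        exact (List.nodup_cons.1 (List.nodup_cons.1 hnd2).2).1 (hγs ▸ List.getLast_mem hR')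
      subst hR'
      have hE := γ.edges_nodup (by rw [hLR]; simp)
      have e2 : γ.verts = (L ++ [t]) ++ [r] := by rw [hLR]; simp
      rw [e2, edges_append _ _ (by simp) (List.cons_ne_nil _ _), List.getLast_append_singleton]
        at hE
      simp only [List.head_cons, List.tail_cons, List.zipWith_nil_right] at hE
      have e3 : s(u, w) :: (List.zipWith (fun u w => s(u, w)) (L ++ [t]) (L ++ [t]).tail ++
          [s(t, r)]) ++ [s(r, t)] =
          (s(u, w) :: List.zipWith (fun u w => s(u, w)) (L ++ [t]) (L ++ [t]).tail ++
            [s(t, r)]) ++ [s(r, t)] := by simp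
      rw [e3, List.nodup_append] at hE
      exact hE.2.2 (s(t, r)) (by simp) (s(r, t)) (List.mem_singleton_self _) Sym2.eq_swap
    refine ⟨⟨r, π, τ⟩, hmemT.2 ⟨tip_mem_star.2 ⟨hrΛ, hch.2.1⟩, ⟨?_, ?_⟩, hrs⟩, ?_⟩
    · rw [hπ]; simp
    · rw [hπ]
      intro h
      rcases List.mem_append.1 h with h | h
      · exact hdis s h s (List.mem_cons_of_mem _ hsR) rfl
      · exact hts.ne (List.mem_singleton.1 h).symm
    · change π.verts ++ τ.verts = γ.verts
      rw [hPQ, ← hπ, ← hτ]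
  · -- glue a prefix and a continuation
    rintro ⟨x, hx, rfl⟩
    obtain ⟨hq, ⟨hl, hsπ⟩, hqs⟩ := hmemT.1 hx
    obtain ⟨-, htq⟩ := tip_mem_star.1 hq
    have hne := hTne hx
    have hhead := har_head_eq x.2.1 hl x.2.2 hne
    refine ⟨glueW x.2.1 x.2.2 hl hhead htq hab, ⟨?_, ?_⟩, rfl⟩
    · change (x.2.1.verts ++ x.2.2.verts).getLast? = some s
      rw [List.getLast?_append, har_getLast_eq x.2.1 hl x.2.2 hne, Option.some_or]
    · change t ∈ x.2.1.verts ++ x.2.2.verts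
      exact List.mem_append_left _ (List.mem_of_getLast? hl)

/-- **The return-loop bound.**  If the `x_c`-mass of the walks of every simply connected domain
between two boundary mid-edges at a common exterior vertex is at most `N ≥ 0`, then for a simply
connected `Λ` with adjacent boundary root `s(u,w)` (`u ∉ Λ`), `t ∈ Λ`, `t ≠ w`, and `s ∈ star Λ t`,
the `x_c`-mass of the return loops at `(t,s)` is at most `N` times the mass of the via-`t` walks
at the other mid-edges `s(t,q)` of `t` avoiding `s`. [folklore] -/
theorem har_returnLoop_le {N : ℝ} (hΛ : hexDomainSimplyConnected Λ) (huw : hexGraph.Adj u w)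
    (hu : u ∉ Λ) (ht : t ∈ Λ) (hwt : w ≠ t) (hs : s ∈ star Λ t) (hN0 : 0 ≤ N)
    (hN : ∀ (Λ' : Finset HexVertex), hexDomainSimplyConnected Λ' → ∀ (t q s : HexVertex),
      t ∉ Λ' → q ∈ Λ' → s ∈ Λ' → hexGraph.Adj t q → hexGraph.Adj t s → q ≠ s →
        (∑ τ : HexMidEdgeSAW Λ' s(t, q) s(s, t), xc ^ τ.length) ≤ N) :
    ∑ γ : HexMidEdgeSAW Λ s(u, w) s(s, t),
        (if γ.verts.getLast? = some s ∧ t ∈ γ.verts then xc ^ γ.length else 0) ≤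
      N * ∑ q ∈ star Λ t, (if q = s then 0 else ∑ π : HexMidEdgeSAW Λ s(u, w) s(t, q),
        if π.verts.getLast? = some t ∧ s ∉ π.verts then xc ^ π.length else 0) := by
  obtain ⟨hsΛ, hts⟩ := tip_mem_star.1 hs
  have h := har_sum_returnLoop hu ht hwt hs (fun l : List HexVertex => (xc : ℝ) ^ l.length)
  simp only [HexMidEdgeSAW.length]
  rw [h, Finset.mul_sum]
  refine Finset.sum_le_sum fun q hq => ?_
  obtain ⟨hqΛ, htq⟩ := tip_mem_star.1 hq
  by_cases hqs : q = s
  · simp [hqs]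
  rw [if_neg hqs, Finset.mul_sum]
  refine Finset.sum_le_sum fun π _ => ?_
  by_cases hC : π.verts.getLast? = some t ∧ s ∉ π.verts
  · rw [if_pos hC, if_neg hqs, if_pos hC]
    simp only [List.length_append, pow_add, ← Finset.mul_sum]
    rw [mul_comm N]
    refine mul_le_mul_of_nonneg_left ?_ (pow_nonneg xc_pos.le _)
    by_cases hqπ : q ∈ π.verts
    · -- no continuation starts at a removed vertex
      haveI : IsEmpty (HexMidEdgeSAW (Λ \ π.verts.toFinset) s(t, q) s(s, t)) := ⟨fun τ => by
        have hne := har_verts_ne_nil hts.ne hqs τ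
        have hh := har_head_eq π hC.1 τ hne
        have hm := (Finset.mem_sdiff.1 (τ.subset q (List.mem_of_mem_head? hh))).2
        exact hm (List.mem_toFinset.2 hqπ)⟩
      simpa using hN0
    · exact hN _ (simplyConnected_sdiff hΛ hu (isChain_cons_verts huw hu π)) t q s
        (fun h => (Finset.mem_sdiff.1 h).2 (List.mem_toFinset.2 (List.mem_of_getLast? hC.1)))
        (Finset.mem_sdiff.2 ⟨hqΛ, fun h => hqπ (List.mem_toFinset.1 h)⟩)
        (Finset.mem_sdiff.2 ⟨hsΛ, fun h => hC.2 (List.mem_toFinset.1 h)⟩) htq hts hqs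
  · rw [if_neg hC, if_neg hC, mul_zero]

end ReturnLoop

/-- **Registered helper `har_returnLoop_bound`** (the return-loop bound `har_returnLoop_le` as a
closed statement): under a bound `N ≥ 0` on the `x_c`-mass of the walks of every simply connected
domain between two boundary mid-edges at a common exterior vertex, the return-loop mass at `(t,s)`
is at most `N` times the mass of the via-`t` walks at the other mid-edges of `t` avoiding `s`.
[folklore] -/
theorem har_returnLoop_bound :
    ∀ (Λ : Finset HexVertex) (u w t s : HexVertex) (N : ℝ), hexDomainSimplyConnected Λ →
    hexGraph.Adj u w → u ∉ Λ → t ∈ Λ → w ≠ t → s ∈ star Λ t → 0 ≤ N → (∀ (Λ' : Finset HexVertex),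
    hexDomainSimplyConnected Λ' → ∀ (t q s : HexVertex), t ∉ Λ' → q ∈ Λ' → s ∈ Λ' → hexGraph.Adj t q
    → hexGraph.Adj t s → q ≠ s → (∑ τ : HexMidEdgeSAW Λ' s(t, q) s(s, t), xc ^ τ.length) ≤ N) → (∑ γ
    : HexMidEdgeSAW Λ s(u, w) s(s, t), (if γ.verts.getLast? = some s ∧ t ∈ γ.verts then xc ^
    γ.length else 0)) ≤ N * ∑ q ∈ star Λ t, (if q = s then 0 else ∑ π : HexMidEdgeSAW Λ s(u, w) s(t,
    q), if π.verts.getLast? = some t ∧ s ∉ π.verts then xc ^ π.length else 0) :=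
  fun _ _ _ _ _ _ hΛ huw hu ht hwt hs hN0 hN => har_returnLoop_le hΛ huw hu ht hwt hs hN0 hN

end Summit.CriticalPhenomena.SAWScalingLimit.Theorems.DefectDecoherence.SectorSlaving

end
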